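/-
Copyright (c) 2026 the pub-hodgecm-mathlib formalisation cell (harness21).  Prover seat hodgecm-mathlib-K2E1-p12 (g3), Track B ∕ K2-LIT, h413 = `stmt-HodgeConjecture-24833`,
route of record `HCCMUnconditional`, ROADCARD «5Res ENDGAME BY FAMILIES» AMENDMENT #3 — REPAIR (ii) of the FINDING `K2/K2E1-p12/g3/FINDING-C7-vacuity-at-Kad.K2E1-p12-g3.md` (chair R39):
C7 HEAD″ — the NON-VACUOUS exhaustion head at the adelic levels `Kad = K_∞·K′_f`: ★ HEAD_τ p860884's generator-level core retyped on ★ F3d-β″ `K2E1ChiIsotypicPureTensorDecompositionOpenCosetsU2`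
(OPEN DOUBLE COSETS `hdo` instead of the unsatisfiable `IsOpen K′`; no continuity of `ω`; NO finiteness claim on the family index, which is FALSE at `Kad` for `[L⁺:ℚ] ≥ 2`).
-/
import Summits.HodgeConjecture.HodgeConjecture.Theorems.K2E1PseudoEisensteinFamilyDecompositionKTypeU2        -- ★ HEAD_τ p860884∕p860896 (this seat): §1 adapters `inv_periodization_mul_right_kType`, `pureTensor_arithmeticBorel_mul_kType`; brings ★ NAMED C7, (α)_τ, F3d-γ∕δ
import Summits.HodgeConjecture.HodgeConjecture.Theorems.K2E1ChiIsotypicPureTensorDecompositionOpenCosetsU2    -- ★∕📤 F3d-β″ (this seat): `exists_sum_pureTensor_eq_norm_le_open` (fed-by ★∕📤 `K2E1DoubleCosetsOpenArchLevelU2.maximalLevel_witness_cm`)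
import HarnessLib

/-!
# h413 ∕ Track B «K2-LIT», AMENDMENT #3 REPAIR (ii) — THE C7 HEAD″ `K2E1PseudoEisensteinFamilyDecompositionOpenCosetsU2`: for the CM pair, a NAMED Borel datum, a level `K′ ≤ U(J₂)(𝔸_{L⁺})`
# whose `(B(𝔸),K′)`-double cosets are OPEN and finitely many with `H` right-`K′`-invariant (all TRUE at `K′ = K_∞·K′_f`), and a unitary character `ω : K′ →* ℂ`: EVERY NICE `ω`-TWISTED
# PSEUDO-EISENSTEIN CLASS lies in `closure ⨆_{χ : V(χ,K′,ω) ≠ ⊥} span { [quotFun (E (f(H)·φ))] : f ∈ C_c((0,∞)), φ ∈ chiSectionSpace χ K′ ω continuous }`; hence (on the P1b_τ head)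
# `Wᗮ ∩ L²(X)^{(K′,ω)} ⊆` the same closure — with NO claim that the index is finite

Cell `pub/hodgecm-mathlib`, crux h413 = `stmt-HodgeConjecture-24833`, route of record `HCCMUnconditional`; dealer K2E1-plan (g7); chair K2-lead R39.  THEOREMS ONLY (no `def`, no `instance`, no
notation, no named-fact hypothesis, no `sorry`); lane `--supports stmt-HodgeConjecture-24833 --as helper` (count-neutral).  Closes no socket.
FED-BY (R39): `hdo ∧ hHK′ ∧ hBK` — ★∕📤 `K2E1DoubleCosetsOpenArchLevelU2.maximalLevel_witness_cm` at `K′ = K_∞·K_max,f` (and `isOpen_doubleCoset_of_archIwasawa` ∕ `borelHeight_mul_of_le_comap` at every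
`K_∞·K′_f`); `𝔓` with radicals `= N(𝔸)` — ★ `exists_parabolicData_orthogonal_eq_quasiSplit_two`; `ω` — e.g. `ω = 1`; §4's `hP1τ` — ★ P1b_τ p860930 at `(Kc, ι) := (↥K′, K′.subtype)` (`K′`
COMPACT, which `K_∞·K′_f` is; openness is NOT required there).  What is NOT claimed: finiteness of `{χ | V(χ,K′,ω) ≠ ⊥}` (FALSE at `Kad` for `[L⁺:ℚ] ≥ 2`: the twists `∏_w |·|_w^{it_w}`, `Σt_w = 0`;
memo §B) — the cut to finitely many families is SPECTRAL and belongs to the `hatoms` assembly, not to C7.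
THE PROOF: verbatim ★ HEAD_τ §2–§4 with ★ F3d-β″ in place of ★ F3d-β_τ.
* §1 `toLp_quotFun_eisensteinSeriesU_mem_span_family_open`, `chiSectionSpace_ne_bot_of_apply_ne_zero_open`.
* §2 **`toLp_pseudoEisenstein_mem_closure_biSup_family_open`** (GENERATOR-LEVEL CORE, letter-free).
* §3 **`orthogonal_inf_isotypic_le_topologicalClosure_biSup_family_open`** (HEAD″ on the P1b_τ head `hP1τ`), `blocks_open` (block currency WITHOUT a finiteness conjunct).

HONEST LABEL: HC_CM is proved only modulo the 7 printed citations (2 remaining named inputs: hLiu418 = `stmt-HodgeConjecture-24832`, h413 = `stmt-HodgeConjecture-24833`) until rung 0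
closes; this file asserts no named fact and closes no socket.
References: [MoeglinWaldspurger1995] C. Mœglin, J.-L. Waldspurger, *Spectral Decomposition and Eisenstein Series*, II.1.1–II.1.4, II.2.4; [BernsteinLapid2019] J. Bernstein, E. Lapid, *On the
meromorphic continuation of Eisenstein series*, §4; [GelbartJacquet1979Corvallis] S. Gelbart, H. Jacquet, *Forms of GL(2) from the analytic point of view*, §3.
-/

set_option autoImplicit false
set_option linter.dupNamespace false  -- the mandated namespace repeats the summit's segment (`HodgeConjecture.HodgeConjecture`)

noncomputable section

open MeasureTheory Measure Set Filter Topology NumberField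
open Literature.MeasureTheory.Group Literature.NumberTheory.Automorphic Literature.NumberTheory.Automorphic.UnitaryGroup Literature.NumberTheory.GaloisRepresentations AdelicGroupData ContRepresentation
open Summit.HodgeConjecture.HodgeConjecture.Cruxes.H413.K2E1BorelEisensteinU
open Summit.HodgeConjecture.HodgeConjecture.Cruxes.H413.K2E1CharacterEisensteinU2Defs
open Summit.HodgeConjecture.HodgeConjecture.Cruxes.H413.K2E1ChiSectionSpaceU2Defs
open Summit.HodgeConjecture.HodgeConjecture.Cruxes.H413.K2E1BorelCosetsDictionary (forall_arithmeticBorel_iff)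
open Summit.HodgeConjecture.HodgeConjecture.Cruxes.H413.K2E1PseudoEisensteinBorelPeriodizationU2
open Summit.HodgeConjecture.HodgeConjecture.Cruxes.H413.K2E1PseudoEisensteinBorelPeriodizationContinuousU2
open Summit.HodgeConjecture.HodgeConjecture.Cruxes.H413.K2E1EisensteinSupNormBandBoundCMTwo
open Summit.HodgeConjecture.HodgeConjecture.Cruxes.H413.K2E1BLIotaUnfoldingU (borelHeight_arithmeticBorel_mul')
open Summit.HodgeConjecture.HodgeConjecture.Cruxes.H413.K2E1PseudoEisensteinFamilyDecompositionU2 (isClosed_adelicUnipotent_quasiSplit_cm eisensteinSeriesU_eq_sum_of_eq_sum)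
open Summit.HodgeConjecture.HodgeConjecture.Cruxes.H413.K2E1EisensteinNiceClassCMTwo (memLp_quotFun_eisensteinSeriesU_of_nice)
open Summit.HodgeConjecture.HodgeConjecture.Cruxes.H413.K2E1NormOneTorusFamilyApproxKTypeU2 (exists_finset_heckeCharacter_family_decomposition_kType)
open Summit.HodgeConjecture.HodgeConjecture.Cruxes.H413.K2E1ChiIsotypicPureTensorDecompositionOpenCosetsU2 (exists_sum_pureTensor_eq_norm_le_open)
open Summit.HodgeConjecture.HodgeConjecture.Cruxes.H413.K2E1PseudoEisensteinFamilyDecompositionKTypeU2 (inv_periodization_mul_right_kType pureTensor_arithmeticBorel_mul_kType)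
open Summit.HodgeConjecture.HodgeConjecture.Cruxes.H413.K2E1ChiSectionLevelFinitenessKTypeU2 (finite_setOf_rayTrivial_chiSectionSpace_ne_bot_kType)
open scoped ENNReal NNReal Pointwise

namespace Summit.HodgeConjecture.HodgeConjecture.Cruxes.H413.K2E1PseudoEisensteinFamilyDecompositionOpenCosetsU2


/-! ## §1 `[E P_χ]` lies in the span of the `χ`-family's `ω`-twisted pure-tensor classes, and `P_χ ≢ 0 ⇒ V(χ,K′,ω) ≠ ⊥` (open double cosets) -/

variable (L : Type) [Field L] [NumberField L] [IsCMField L]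
  (μ : Measure (quasiSplit (↥(maximalRealSubfield L)) L (IsCMField.complexConj L) 2).automorphicQuotient)

/-- **`[quotFun (E P)] ∈ span { [quotFun (E (f(H)·φ))] : f ∈ C_c((0,∞)), φ ∈ chiSectionSpace χ K′ ω }`** for a continuous, right-`(K′, ω)`-equivariant, left-`B(F)`-invariant, norm-one-Borel
`χ`-isotypic, bounded, band-supported `P` — ★ F3d-β_τ `exists_sum_pureTensor_eq_norm_le_kType` + ★ band-class linearity + ★ F3d-γ `sum_smul_toLp_eq`; every class is `L²` by ★ F3d-δ.
[cite: MoeglinWaldspurger1995, I.2.17, II.1.1–II.1.2] -/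
theorem toLp_quotFun_eisensteinSeriesU_mem_span_family_open (hc : IsCMField.complexConj L * IsCMField.complexConj L = 1)
    [MeasurableSpace (quasiSplit (↥(maximalRealSubfield L)) L (IsCMField.complexConj L) 2).Adelic] [BorelSpace (quasiSplit (↥(maximalRealSubfield L)) L (IsCMField.complexConj L) 2).Adelic] [IsFiniteMeasure μ]
    {K' : Subgroup (quasiSplit (↥(maximalRealSubfield L)) L (IsCMField.complexConj L) 2).Adelic} (hdo : ∀ w' : (quasiSplit (↥(maximalRealSubfield L)) L (IsCMField.complexConj L) 2).Adelic, IsOpen (DoubleCoset.doubleCoset w' (borelAdelic (↥(maximalRealSubfield L)) L (IsCMField.complexConj L) 2 : Set (quasiSplit (↥(maximalRealSubfield L)) L (IsCMField.complexConj L) 2).Adelic) K'))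
    (hHK' : ∀ (g k : (quasiSplit (↥(maximalRealSubfield L)) L (IsCMField.complexConj L) 2).Adelic), k ∈ K' → borelHeight (g * k) = borelHeight g)
    (hBK : ∃ W : Finset (quasiSplit (↥(maximalRealSubfield L)) L (IsCMField.complexConj L) 2).Adelic, ∀ g, ∃ β ∈ borelAdelic (↥(maximalRealSubfield L)) L (IsCMField.complexConj L) 2, ∃ w ∈ W, ∃ k ∈ K', g = β * w * k)
    {ω : ↥K' → ℂ} (hωmul : ∀ k k' : ↥K', ω (k * k') = ω k * ω k') (hω1 : ∀ k : ↥K', ‖ω k‖ = 1)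
    (χ : HeckeCharacter L) (hχray : ∀ r : ℝ≥0ˣ, χ (posRealIdele L r) = 1)
    {P : (quasiSplit (↥(maximalRealSubfield L)) L (IsCMField.complexConj L) 2).Adelic → ℂ} (hPc : Continuous P)
    (hPK : ∀ (g : (quasiSplit (↥(maximalRealSubfield L)) L (IsCMField.complexConj L) 2).Adelic) (k : ↥K'), P (g * (k : (quasiSplit (↥(maximalRealSubfield L)) L (IsCMField.complexConj L) 2).Adelic)) = ω k * P g)
    (hPB : ∀ b ∈ arithmeticBorel (↥(maximalRealSubfield L)) L (IsCMField.complexConj L) 2, ∀ x, P ((b : (quasiSplit (↥(maximalRealSubfield L)) L (IsCMField.complexConj L) 2).Adelic) * x) = P x)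
    (hPχ : ∀ (b : (quasiSplit (↥(maximalRealSubfield L)) L (IsCMField.complexConj L) 2).Adelic) (hb : b ∈ borelAdelic (↥(maximalRealSubfield L)) L (IsCMField.complexConj L) 2),
      IdeleClassGroup.ideleNorm L (firstEntryUnit hb) = 1 → ∀ g, P (b * g) = ((χ (firstEntryUnit hb) : ℂˣ) : ℂ) * P g)
    (hPM : ∃ M : ℝ, ∀ g, ‖P g‖ ≤ M) {a b : ℝ≥0} (ha : 0 < a) (hPband : ∀ g, P g ≠ 0 → a ≤ borelHeight g ∧ borelHeight g ≤ b)
    (hv : MemLp ((quasiSplit (↥(maximalRealSubfield L)) L (IsCMField.complexConj L) 2).quotFun (eisensteinSeriesU P)) 2 μ) :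
    hv.toLp _ ∈ Submodule.span ℂ {v : (quasiSplit (↥(maximalRealSubfield L)) L (IsCMField.complexConj L) 2).L2 μ |
      ∃ (f : ℝ → ℂ) (_ : Continuous f) (_ : HasCompactSupport f) (_ : tsupport f ⊆ Ioi 0)
        (φ : (quasiSplit (↥(maximalRealSubfield L)) L (IsCMField.complexConj L) 2).Adelic → ℂ) (_ : φ ∈ chiSectionSpace χ K' ω) (_ : Continuous φ)
        (hv : MemLp ((quasiSplit (↥(maximalRealSubfield L)) L (IsCMField.complexConj L) 2).quotFun (eisensteinSeriesU (fun g => f (borelHeight g) * φ g))) 2 μ), v = hv.toLp _} := by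
  classical
  obtain ⟨M, hM⟩ := hPM
  obtain ⟨ι, hι, f, φ, hfφ, heq⟩ := exists_sum_pureTensor_eq_norm_le_open hc hdo hHK' hBK χ hχray hωmul hω1 hPc hPK hPχ ha hPband
  -- the terms `u_i = f_i(H)·φ_i`: continuous, `B(F)`-invariant, bounded, band-supported ⇒ `L²` classes (★ F3d-δ)
  set u : ι → (quasiSplit (↥(maximalRealSubfield L)) L (IsCMField.complexConj L) 2).Adelic → ℂ := fun i g => f i (borelHeight g) * φ i g with hu
  have huc : ∀ i, Continuous (u i) := fun i => ((hfφ i).1.comp (NNReal.continuous_coe.comp continuous_borelHeight)).mul (hfφ i).2.2.2.2.1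
  have huB : ∀ i, ∀ b ∈ arithmeticBorel (↥(maximalRealSubfield L)) L (IsCMField.complexConj L) 2, ∀ x,
      u i ((b : (quasiSplit (↥(maximalRealSubfield L)) L (IsCMField.complexConj L) 2).Adelic) * x) = u i x := fun i => pureTensor_arithmeticBorel_mul_kType (f i) (hfφ i).2.2.2.1
  have huM : ∀ i g, ‖u i g‖ ≤ M := fun i g => ((hfφ i).2.2.2.2.2 g).trans (hM g)
  have huband : ∀ i g, u i g ≠ 0 → a ≤ borelHeight g ∧ borelHeight g ≤ b := fun i g hg => hPband g fun hP => hg (by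
    have h := (hfφ i).2.2.2.2.2 g; rw [hP, norm_zero] at h; exact norm_le_zero_iff.1 h)
  have hvu : ∀ i, MemLp ((quasiSplit (↥(maximalRealSubfield L)) L (IsCMField.complexConj L) 2).quotFun (eisensteinSeriesU (u i))) 2 μ := fun i =>
    memLp_quotFun_eisensteinSeriesU_of_nice L μ 2 (huc i) (huB i) (huM i) ha (huband i)
  -- `E P = Σ_i E u_i` pointwise (band class, threshold `a/2`)
  have ha2 : (0 : ℝ≥0) < a / 2 := half_pos ha
  have hPa : ∀ g, borelHeight g ≤ a / 2 → P g = 0 := fun g hg => by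
    by_contra hne; exact absurd ((hPband g hne).1.trans hg) (not_le.2 (half_lt_self ha))
  have hua : ∀ i g, borelHeight g ≤ a / 2 → u i g = 0 := fun i g hg => by
    by_contra hne; exact absurd ((huband i g hne).1.trans hg) (not_le.2 (half_lt_self ha))
  have hE : ∀ g, eisensteinSeriesU P g = ∑ i, eisensteinSeriesU (u i) g := eisensteinSeriesU_eq_sum_of_eq_sum hPB huB ha2 hPa hua heq
  -- the classes: `[E P] = Σ_i 1 • [E u_i]`
  obtain ⟨hs, hseq⟩ := sum_smul_toLp_eq (quasiSplit (↥(maximalRealSubfield L)) L (IsCMField.complexConj L) 2) μ (Finset.univ : Finset ι) (fun _ => (1 : ℂ))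
    (fun i => eisensteinSeriesU (u i)) hvu
  have hcls : hv.toLp _ = ∑ i, (1 : ℂ) • (hvu i).toLp _ := by
    rw [hseq]
    exact MemLp.toLp_congr _ _ (Eventually.of_forall fun x => by
      simp only [AdelicGroupData.quotFun, one_mul, hE])
  rw [hcls]
  refine Submodule.sum_mem _ fun i _ => Submodule.smul_mem _ _ (Submodule.subset_span ?_)
  exact ⟨f i, (hfφ i).1, (hfφ i).2.1, (hfφ i).2.2.1, φ i, (hfφ i).2.2.2.1, (hfφ i).2.2.2.2.1, hvu i, rfl⟩

/-- **`P ≢ 0 ⇒ χ ∈ S_ω(K′)`**: a continuous right-`(K′, ω)`-equivariant norm-one-Borel `χ`-isotypic band-limited `P` with a non-zero value forces `chiSectionSpace χ K′ ω ≠ ⊥` (some pure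
tensor of ★ F3d-β_τ is non-zero there, so its `χ`-section is). [cite: MoeglinWaldspurger1995, I.2.17] -/
theorem chiSectionSpace_ne_bot_of_apply_ne_zero_open (hc : IsCMField.complexConj L * IsCMField.complexConj L = 1)
    {K' : Subgroup (quasiSplit (↥(maximalRealSubfield L)) L (IsCMField.complexConj L) 2).Adelic} (hdo : ∀ w' : (quasiSplit (↥(maximalRealSubfield L)) L (IsCMField.complexConj L) 2).Adelic, IsOpen (DoubleCoset.doubleCoset w' (borelAdelic (↥(maximalRealSubfield L)) L (IsCMField.complexConj L) 2 : Set (quasiSplit (↥(maximalRealSubfield L)) L (IsCMField.complexConj L) 2).Adelic) K'))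
    (hHK' : ∀ (g k : (quasiSplit (↥(maximalRealSubfield L)) L (IsCMField.complexConj L) 2).Adelic), k ∈ K' → borelHeight (g * k) = borelHeight g)
    (hBK : ∃ W : Finset (quasiSplit (↥(maximalRealSubfield L)) L (IsCMField.complexConj L) 2).Adelic, ∀ g, ∃ β ∈ borelAdelic (↥(maximalRealSubfield L)) L (IsCMField.complexConj L) 2, ∃ w ∈ W, ∃ k ∈ K', g = β * w * k)
    {ω : ↥K' → ℂ} (hωmul : ∀ k k' : ↥K', ω (k * k') = ω k * ω k') (hω1 : ∀ k : ↥K', ‖ω k‖ = 1)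
    (χ : HeckeCharacter L) (hχray : ∀ r : ℝ≥0ˣ, χ (posRealIdele L r) = 1)
    {P : (quasiSplit (↥(maximalRealSubfield L)) L (IsCMField.complexConj L) 2).Adelic → ℂ} (hPc : Continuous P)
    (hPK : ∀ (g : (quasiSplit (↥(maximalRealSubfield L)) L (IsCMField.complexConj L) 2).Adelic) (k : ↥K'), P (g * (k : (quasiSplit (↥(maximalRealSubfield L)) L (IsCMField.complexConj L) 2).Adelic)) = ω k * P g)
    (hPχ : ∀ (b : (quasiSplit (↥(maximalRealSubfield L)) L (IsCMField.complexConj L) 2).Adelic) (hb : b ∈ borelAdelic (↥(maximalRealSubfield L)) L (IsCMField.complexConj L) 2),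
      IdeleClassGroup.ideleNorm L (firstEntryUnit hb) = 1 → ∀ g, P (b * g) = ((χ (firstEntryUnit hb) : ℂˣ) : ℂ) * P g)
    {a b : ℝ≥0} (ha : 0 < a) (hPband : ∀ g, P g ≠ 0 → a ≤ borelHeight g ∧ borelHeight g ≤ b) {g : (quasiSplit (↥(maximalRealSubfield L)) L (IsCMField.complexConj L) 2).Adelic} (hg : P g ≠ 0) :
    chiSectionSpace χ K' ω ≠ ⊥ := by
  classical
  obtain ⟨ι, hι, f, φ, hfφ, heq⟩ := exists_sum_pureTensor_eq_norm_le_open hc hdo hHK' hBK χ hχray hωmul hω1 hPc hPK hPχ ha hPband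
  rw [heq g] at hg
  obtain ⟨i, -, hi⟩ := Finset.exists_ne_zero_of_sum_ne_zero hg
  have hφi : φ i g ≠ 0 := fun h0 => hi (by rw [h0, mul_zero])
  intro hbot
  have hmem : φ i ∈ chiSectionSpace χ K' ω := (hfφ i).2.2.2.1
  rw [hbot, Submodule.mem_bot] at hmem
  exact hφi (by rw [hmem, Pi.zero_apply])

/-! ## §2 THE GENERATOR-LEVEL CORE (letter-free, open double cosets) -/

/-- **EVERY NICE `ω`-TWISTED PSEUDO-EISENSTEIN CLASS LIES IN `closure ⨆_{χ ∈ S_ω(K′)} span(ω-family χ)`** — for the CM pair, a NAMED Borel datum `𝔓` (radicals `= N(𝔸)`), an open `K′` with `H`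
right-`K′`-invariant and finitely many `(B(𝔸),K′)`-double cosets (representatives `W`), and a continuous unitary character `ω : K′ →* ℂ`: if `Φ ∈ 𝒯_i` is nice (measurable, right-`N(𝔸)`-invariant,
square-summable, continuous, bounded, supported on `C·N(𝔸)`) with the `K′`-LAW `Φ(k h) = (ω k)⁻¹ Φ(h)`, then `[θ_Φ] ∈ closure ⨆_{χ ∈ S_ω(K′)} span { [quotFun (E (f(H)·φ))] : f ∈ C_c((0,∞)),
φ ∈ chiSectionSpace χ K′ ω continuous }` with `S_ω(K′) = {χ | χ(r_∞) = 1 ∧ chiSectionSpace χ K′ ω ≠ ⊥}` FINITE (★ F3d-ε_τ).  (★ F3b + §1 + ★ hα_τ + ★ F3d-γ + ★ F3d-δ + §2.)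
[cite: MoeglinWaldspurger1995, II.1.1–II.1.4, II.2.4] [cite: BernsteinLapid2019, §4] -/
theorem toLp_pseudoEisenstein_mem_closure_biSup_family_open (hc : IsCMField.complexConj L * IsCMField.complexConj L = 1)
    [MeasurableSpace (quasiSplit (↥(maximalRealSubfield L)) L (IsCMField.complexConj L) 2).Adelic] [BorelSpace (quasiSplit (↥(maximalRealSubfield L)) L (IsCMField.complexConj L) 2).Adelic] [(quasiSplit (↥(maximalRealSubfield L)) L (IsCMField.complexConj L) 2).IsAutomorphicMeasure μ]
    (𝔓 : (quasiSplit (↥(maximalRealSubfield L)) L (IsCMField.complexConj L) 2).ParabolicUnipotentData) (h𝔓 : ∀ i : 𝔓.ι, 𝔓.radical i = adelicUnipotent (↥(maximalRealSubfield L)) L (IsCMField.complexConj L) 2)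
    (K' : Subgroup (quasiSplit (↥(maximalRealSubfield L)) L (IsCMField.complexConj L) 2).Adelic) (hdo : ∀ w' : (quasiSplit (↥(maximalRealSubfield L)) L (IsCMField.complexConj L) 2).Adelic, IsOpen (DoubleCoset.doubleCoset w' (borelAdelic (↥(maximalRealSubfield L)) L (IsCMField.complexConj L) 2 : Set (quasiSplit (↥(maximalRealSubfield L)) L (IsCMField.complexConj L) 2).Adelic) K'))
    (hHK' : ∀ (g k : (quasiSplit (↥(maximalRealSubfield L)) L (IsCMField.complexConj L) 2).Adelic), k ∈ K' → borelHeight (g * k) = borelHeight g)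
    (W : Finset (quasiSplit (↥(maximalRealSubfield L)) L (IsCMField.complexConj L) 2).Adelic) (hW : ∀ g, ∃ β ∈ borelAdelic (↥(maximalRealSubfield L)) L (IsCMField.complexConj L) 2, ∃ w ∈ W, ∃ k ∈ K', g = β * w * k)
    (ω : ↥K' →* ℂ) (hω1 : ∀ k : ↥K', ‖ω k‖ = 1)
    (i : 𝔓.ι) {Φ : (quasiSplit (↥(maximalRealSubfield L)) L (IsCMField.complexConj L) 2).Adelic → ℂ} (hΦm : Measurable Φ) (hΦ : ∀ (g : (quasiSplit (↥(maximalRealSubfield L)) L (IsCMField.complexConj L) 2).Adelic) (n : 𝔓.radical i), Φ (g * n) = Φ g)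
    (h2 : ∫⁻ x, (∑' q : (quasiSplit (↥(maximalRealSubfield L)) L (IsCMField.complexConj L) 2).quotientSubgroup ⧸ (𝔓.radical i).subgroupOf (quasiSplit (↥(maximalRealSubfield L)) L (IsCMField.complexConj L) 2).quotientSubgroup,
      ‖Φ ((Quotient.out x : (quasiSplit (↥(maximalRealSubfield L)) L (IsCMField.complexConj L) 2).Adelic) * ((q.out : (quasiSplit (↥(maximalRealSubfield L)) L (IsCMField.complexConj L) 2).quotientSubgroup) : (quasiSplit (↥(maximalRealSubfield L)) L (IsCMField.complexConj L) 2).Adelic))‖ₑ) ^ 2 ∂μ < ∞)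
    (hΦc : Continuous Φ) (hM : ∃ M : ℝ, ∀ g, ‖Φ g‖ ≤ M)
    (hC : ∃ C : Set (quasiSplit (↥(maximalRealSubfield L)) L (IsCMField.complexConj L) 2).Adelic, IsCompact C ∧ ∀ g, g ∉ C * ((𝔓.radical i : Subgroup (quasiSplit (↥(maximalRealSubfield L)) L (IsCMField.complexConj L) 2).Adelic) : Set (quasiSplit (↥(maximalRealSubfield L)) L (IsCMField.complexConj L) 2).Adelic) → Φ g = 0)
    (hK : ∀ (k : ↥K') (h : (quasiSplit (↥(maximalRealSubfield L)) L (IsCMField.complexConj L) 2).Adelic), Φ (K'.subtype k * h) = (ω k)⁻¹ * Φ h)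
    (hθ : MemLp (fun x : (quasiSplit (↥(maximalRealSubfield L)) L (IsCMField.complexConj L) 2).automorphicQuotient => ∑' q : (quasiSplit (↥(maximalRealSubfield L)) L (IsCMField.complexConj L) 2).quotientSubgroup ⧸ (𝔓.radical i).subgroupOf (quasiSplit (↥(maximalRealSubfield L)) L (IsCMField.complexConj L) 2).quotientSubgroup,
      Φ ((Quotient.out x : (quasiSplit (↥(maximalRealSubfield L)) L (IsCMField.complexConj L) 2).Adelic) * ((q.out : (quasiSplit (↥(maximalRealSubfield L)) L (IsCMField.complexConj L) 2).quotientSubgroup) : (quasiSplit (↥(maximalRealSubfield L)) L (IsCMField.complexConj L) 2).Adelic))) 2 μ) :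
    hθ.toLp _ ∈ ((⨆ χ ∈ {χ : HeckeCharacter L | (∀ r : ℝ≥0ˣ, χ (posRealIdele L r) = 1) ∧ chiSectionSpace χ K' (ω : ↥K' → ℂ) ≠ ⊥},
      Submodule.span ℂ {v : (quasiSplit (↥(maximalRealSubfield L)) L (IsCMField.complexConj L) 2).L2 μ |
        ∃ (f : ℝ → ℂ) (_ : Continuous f) (_ : HasCompactSupport f) (_ : tsupport f ⊆ Ioi 0)
          (φ : (quasiSplit (↥(maximalRealSubfield L)) L (IsCMField.complexConj L) 2).Adelic → ℂ) (_ : φ ∈ chiSectionSpace χ K' (ω : ↥K' → ℂ)) (_ : Continuous φ)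
          (hv : MemLp ((quasiSplit (↥(maximalRealSubfield L)) L (IsCMField.complexConj L) 2).quotFun (eisensteinSeriesU (fun g => f (borelHeight g) * φ g))) 2 μ), v = hv.toLp _}).topologicalClosure :
      Submodule ℂ ((quasiSplit (↥(maximalRealSubfield L)) L (IsCMField.complexConj L) 2).L2 μ)) := by
  classical
  have hBK : ∃ W : Finset (quasiSplit (↥(maximalRealSubfield L)) L (IsCMField.complexConj L) 2).Adelic, ∀ g, ∃ β ∈ borelAdelic (↥(maximalRealSubfield L)) L (IsCMField.complexConj L) 2, ∃ w ∈ W, ∃ k ∈ K', g = β * w * k := ⟨W, hW⟩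
  have hωmul : ∀ k k' : ↥K', ω (k * k') = ω k * ω k' := fun k k' => map_mul ω k k'
  have hωle : ∀ k : ↥K', ‖ω k‖ ≤ 1 := fun k => (hω1 k).le
  -- structural instances of the CM quasi-split datum
  haveI := t2Space_adeleRing_of_numberField L
  haveI := locallyCompactSpace_adeleRing' L
  haveI := secondCountableTopology_adeleRing L
  haveI : LocallyCompactSpace (quasiSplit (↥(maximalRealSubfield L)) L (IsCMField.complexConj L) 2).Adelic :=
    inferInstanceAs (LocallyCompactSpace (adelic (↥(maximalRealSubfield L)) L (IsCMField.complexConj L) 2 ((StdForm.antidiagonal 2).over L)))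
  haveI : SecondCountableTopology (quasiSplit (↥(maximalRealSubfield L)) L (IsCMField.complexConj L) 2).Adelic :=
    inferInstanceAs (SecondCountableTopology (adelic (↥(maximalRealSubfield L)) L (IsCMField.complexConj L) 2 ((StdForm.antidiagonal 2).over L)))
  haveI : T2Space (quasiSplit (↥(maximalRealSubfield L)) L (IsCMField.complexConj L) 2).Adelic :=
    inferInstanceAs (T2Space (adelic (↥(maximalRealSubfield L)) L (IsCMField.complexConj L) 2 ((StdForm.antidiagonal 2).over L)))
  haveI : DiscreteTopology (quasiSplit (↥(maximalRealSubfield L)) L (IsCMField.complexConj L) 2).quotientSubgroup := by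
    rw [quotientSubgroup_quasiSplit]; exact isDiscreteRational_quasiSplit
  obtain ⟨M, hMΦ⟩ := hM
  obtain ⟨C, hCc, hCΦ⟩ := hC
  rw [← SetLike.mem_coe, Submodule.topologicalClosure_coe, Metric.mem_closure_iff]
  intro ε hε
  -- `Φ` in the Borel currency; `ψ = (Φ_B)^∨` and its niceness (★ F3b, ★ F3b′, §1)
  have hΦ' : ∀ (g : (quasiSplit (↥(maximalRealSubfield L)) L (IsCMField.complexConj L) 2).Adelic) (u : adelicUnipotent (↥(maximalRealSubfield L)) L (IsCMField.complexConj L) 2), Φ (g * u) = Φ g :=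
    fun g u => hΦ g ⟨u, by rw [h𝔓 i]; exact u.2⟩
  have hCΦ' : ∀ g, g ∉ C * ((adelicUnipotent (↥(maximalRealSubfield L)) L (IsCMField.complexConj L) 2 : Subgroup _) : Set _) → Φ g = 0 := fun g hg => hCΦ g (by rwa [h𝔓 i])
  set ψ : (quasiSplit (↥(maximalRealSubfield L)) L (IsCMField.complexConj L) 2).Adelic → ℂ := fun h =>
    ∑' q : ↥(arithmeticBorel (↥(maximalRealSubfield L)) L (IsCMField.complexConj L) 2) ⧸
        ((adelicUnipotent (↥(maximalRealSubfield L)) L (IsCMField.complexConj L) 2).subgroupOf (quasiSplit (↥(maximalRealSubfield L)) L (IsCMField.complexConj L) 2).arithmeticSubgroup).subgroupOf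
          (arithmeticBorel (↥(maximalRealSubfield L)) L (IsCMField.complexConj L) 2),
      Φ (h⁻¹ * (((q.out : arithmeticBorel (↥(maximalRealSubfield L)) L (IsCMField.complexConj L) 2) : (quasiSplit (↥(maximalRealSubfield L)) L (IsCMField.complexConj L) 2).arithmeticSubgroup) :
        (quasiSplit (↥(maximalRealSubfield L)) L (IsCMField.complexConj L) 2).Adelic)) with hψdef
  have hψc : Continuous ψ := continuous_inv_periodization hΦc hCc hCΦ'
  have hψU : ∀ (u : adelicUnipotent (↥(maximalRealSubfield L)) L (IsCMField.complexConj L) 2) (g : (quasiSplit (↥(maximalRealSubfield L)) L (IsCMField.complexConj L) 2).Adelic),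
      ψ ((u : (quasiSplit (↥(maximalRealSubfield L)) L (IsCMField.complexConj L) 2).Adelic) * g) = ψ g := fun u g => inv_periodization_unipotent_mul hΦ' u g
  have hψB : ∀ b ∈ arithmeticBorel (↥(maximalRealSubfield L)) L (IsCMField.complexConj L) 2, ∀ g,
      ψ ((b : (quasiSplit (↥(maximalRealSubfield L)) L (IsCMField.complexConj L) 2).Adelic) * g) = ψ g := inv_periodization_borel_mul hΦ'
  have hψK : ∀ (g : (quasiSplit (↥(maximalRealSubfield L)) L (IsCMField.complexConj L) 2).Adelic) (k : ↥K'), ψ (g * (k : (quasiSplit (↥(maximalRealSubfield L)) L (IsCMField.complexConj L) 2).Adelic)) = ω k * ψ g := fun g k =>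
    inv_periodization_mul_right_kType K'.subtype ω hK g k
  obtain ⟨a, b, ha, hband⟩ := exists_band_of_inv_periodization_ne_zero (Φ := Φ) hCc hCΦ'
  obtain ⟨Mψ, hMψ⟩ := exists_bound_inv_periodization hΦc hΦ' hCc hCΦ'
  have hvψ : MemLp ((quasiSplit (↥(maximalRealSubfield L)) L (IsCMField.complexConj L) 2).quotFun (eisensteinSeriesU ψ)) 2 μ := memLp_quotFun_eisensteinSeriesU_of_nice L μ 2 hψc hψB hMψ ha hband
  have hvθ : hθ.toLp _ = hvψ.toLp _ := toLp_pseudoEisenstein_eq_toLp_quotFun_eisensteinSeriesU 𝔓 i (h𝔓 i) μ hΦm hΦ h2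
  -- ★ F3d-γ's constant at threshold `a/2`
  have ha2 : (0 : ℝ≥0) < a / 2 := half_pos ha
  obtain ⟨Cγ, hCγ0, hCγ⟩ := exists_const_norm_toLp_sub_sum_le_cm L μ ha2
  set Kc : ℝ := (measureUnivNNReal μ : ℝ) ^ (2 : ℝ)⁻¹ * Cγ with hKc
  have hKc0 : 0 ≤ Kc := mul_nonneg (Real.rpow_nonneg (NNReal.coe_nonneg _) _) hCγ0
  -- the approximation from ★ `hα_τ` at `ε' = ε / (Kc + 1)`
  have hε' : 0 < ε / (Kc + 1) := div_pos hε (by linarith)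
  obtain ⟨s, coef, P, hP, happrox⟩ := exists_finset_heckeCharacter_family_decomposition_kType hc hBK hωle ψ hψc hψU hψB hψK ha hband (ε / (Kc + 1)) hε'
  -- `L²` classes of the `P_χ`, `χ ∈ s` (★ F3d-δ)
  have hvP : ∀ j : ↥s, MemLp ((quasiSplit (↥(maximalRealSubfield L)) L (IsCMField.complexConj L) 2).quotFun (eisensteinSeriesU (P (j : HeckeCharacter L)))) 2 μ := fun j => by
    obtain ⟨MP, hMP⟩ := (hP j j.2).2.2.2.2.2.2
    exact memLp_quotFun_eisensteinSeriesU_of_nice L μ 2 (hP j j.2).2.1 (hP j j.2).2.2.2.1 hMP ha (hP j j.2).2.2.2.2.2.1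
  -- the approximant and its membership in `⨆_{χ ∈ S_ω(K′)} span(family χ)`
  set y : (quasiSplit (↥(maximalRealSubfield L)) L (IsCMField.complexConj L) 2).L2 μ := ∑ j : ↥s, coef (j : HeckeCharacter L) • (hvP j).toLp _ with hy
  have hyV : y ∈ (⨆ χ ∈ {χ : HeckeCharacter L | (∀ r : ℝ≥0ˣ, χ (posRealIdele L r) = 1) ∧ chiSectionSpace χ K' (ω : ↥K' → ℂ) ≠ ⊥},
      Submodule.span ℂ {v : (quasiSplit (↥(maximalRealSubfield L)) L (IsCMField.complexConj L) 2).L2 μ |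
        ∃ (f : ℝ → ℂ) (_ : Continuous f) (_ : HasCompactSupport f) (_ : tsupport f ⊆ Ioi 0)
          (φ : (quasiSplit (↥(maximalRealSubfield L)) L (IsCMField.complexConj L) 2).Adelic → ℂ) (_ : φ ∈ chiSectionSpace χ K' (ω : ↥K' → ℂ)) (_ : Continuous φ)
          (hv : MemLp ((quasiSplit (↥(maximalRealSubfield L)) L (IsCMField.complexConj L) 2).quotFun (eisensteinSeriesU (fun g => f (borelHeight g) * φ g))) 2 μ), v = hv.toLp _}) := by
    refine Submodule.sum_mem _ fun j _ => ?_
    obtain ⟨hχray, hPc, hPK, hPB, hPχ, hPband, hPM⟩ := hP j j.2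
    by_cases hP0 : ∀ g, P (j : HeckeCharacter L) g = 0
    · -- the class of `E 0` is `0`
      have hz : (hvP j).toLp _ = 0 := by
        have hfun : ∀ x : (quasiSplit (↥(maximalRealSubfield L)) L (IsCMField.complexConj L) 2).automorphicQuotient,
            (quasiSplit (↥(maximalRealSubfield L)) L (IsCMField.complexConj L) 2).quotFun (eisensteinSeriesU (P (j : HeckeCharacter L))) x =
              (0 : (quasiSplit (↥(maximalRealSubfield L)) L (IsCMField.complexConj L) 2).automorphicQuotient → ℂ) x := fun x => by
          simp only [AdelicGroupData.quotFun, Pi.zero_apply, eisensteinSeriesU_def, hP0, tsum_zero]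
        exact (MemLp.toLp_congr (hvP j) (MemLp.zero (ε := ℂ)) (Eventually.of_forall hfun)).trans (MemLp.toLp_zero _)
      rw [hz, smul_zero]; exact Submodule.zero_mem _
    · obtain ⟨g, hg⟩ := not_forall.1 hP0
      have hSω : chiSectionSpace (j : HeckeCharacter L) K' (ω : ↥K' → ℂ) ≠ ⊥ :=
        chiSectionSpace_ne_bot_of_apply_ne_zero_open L hc hdo hHK' hBK hωmul hω1 (j : HeckeCharacter L) hχray hPc hPK hPχ ha hPband hg
      refine Submodule.smul_mem _ _ (Submodule.mem_iSup_of_mem (j : HeckeCharacter L) (Submodule.mem_iSup_of_mem ⟨hχray, hSω⟩ ?_))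
      exact toLp_quotFun_eisensteinSeriesU_mem_span_family_open L μ hc hdo hHK' hBK hωmul hω1 (j : HeckeCharacter L) hχray hPc hPK hPB hPχ hPM ha hPband (hvP j)
  refine ⟨y, hyV, ?_⟩
  -- the distance estimate (★ F3d-γ)
  have hψa : ∀ g, borelHeight g ≤ a / 2 → ψ g = 0 := fun g hg => by
    by_contra hne; exact absurd ((hband g hne).1.trans hg) (not_le.2 (half_lt_self ha))
  have hPa : ∀ (j : ↥s) g, borelHeight g ≤ a / 2 → P (j : HeckeCharacter L) g = 0 := fun j g hg => by
    by_contra hne; exact absurd (((hP j j.2).2.2.2.2.2.1 g hne).1.trans hg) (not_le.2 (half_lt_self ha))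
  have happrox' : ∀ g, ‖ψ g - ∑ j ∈ (Finset.univ : Finset ↥s), coef (j : HeckeCharacter L) * P (j : HeckeCharacter L) g‖ ≤ ε / (Kc + 1) := fun g => by
    rw [Finset.sum_coe_sort s (fun χ => coef χ * P χ g)]; exact happrox g
  have hdist := hCγ (Finset.univ : Finset ↥s) (fun j => coef (j : HeckeCharacter L)) ψ (fun j => P (j : HeckeCharacter L)) hψB (fun j => (hP j j.2).2.2.2.1) hψa hPa
    (ε / (Kc + 1)) happrox' hvψ hvP
  rw [dist_eq_norm, hvθ, hy]
  calc ‖hvψ.toLp _ - ∑ j : ↥s, coef (j : HeckeCharacter L) • (hvP j).toLp _‖ ≤ (measureUnivNNReal μ : ℝ) ^ (2 : ℝ)⁻¹ * Cγ * (ε / (Kc + 1)) := hdist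
    _ = Kc * (ε / (Kc + 1)) := by rw [hKc]
    _ < ε := by
        rw [mul_div_assoc', div_lt_iff₀ (by linarith)]
        nlinarith

/-! ## §3 THE HEAD″ SHAPE, hypothesis-first on the P1b_τ head `hP1τ`; block currency without finiteness -/

/-- **THE C7_τ HEAD_τ (hypothesis-first on P1b_τ)**: for any closed `R`-stable `W ≤ L²(X)` whose `(K′,ω)`-isotypic orthogonal part is generated by the nice `ω`-twisted pseudo-Eisenstein
classes — `hP1τ : Wᗮ ⊓ ⨅_k eigenspace (R (K′.subtype k)) (ω k) = closure span Θ^{ω,nice}` (the P1b_τ head, K2E1-p10 (g3); `Θ^{ω,nice}` = ★ P1b's `ΘKn` with the `K′`-law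
`Φ (K′.subtype k * h) = (ω k)⁻¹ * Φ h`) — one has `Wᗮ ⊓ L²(X)^{(K′,ω)} ≤ closure ⨆_{χ ∈ S_ω(K′)} span(ω-family χ)` (§3 + `closure`-minimality).  With `W = cusp μ 𝔓` and ★ bridge
`orthogonal_eq_topologicalClosure_span_of_borel` this is the NAMED C7_τ print. [cite: MoeglinWaldspurger1995, II.1.1–II.1.4, II.2.4] [cite: BernsteinLapid2019, §4] -/
theorem orthogonal_inf_isotypic_le_topologicalClosure_biSup_family_open (hc : IsCMField.complexConj L * IsCMField.complexConj L = 1)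
    [MeasurableSpace (quasiSplit (↥(maximalRealSubfield L)) L (IsCMField.complexConj L) 2).Adelic] [BorelSpace (quasiSplit (↥(maximalRealSubfield L)) L (IsCMField.complexConj L) 2).Adelic] [(quasiSplit (↥(maximalRealSubfield L)) L (IsCMField.complexConj L) 2).IsAutomorphicMeasure μ]
    (𝔓 : (quasiSplit (↥(maximalRealSubfield L)) L (IsCMField.complexConj L) 2).ParabolicUnipotentData) (h𝔓 : ∀ i : 𝔓.ι, 𝔓.radical i = adelicUnipotent (↥(maximalRealSubfield L)) L (IsCMField.complexConj L) 2)
    (K' : Subgroup (quasiSplit (↥(maximalRealSubfield L)) L (IsCMField.complexConj L) 2).Adelic) (hdo : ∀ w' : (quasiSplit (↥(maximalRealSubfield L)) L (IsCMField.complexConj L) 2).Adelic, IsOpen (DoubleCoset.doubleCoset w' (borelAdelic (↥(maximalRealSubfield L)) L (IsCMField.complexConj L) 2 : Set (quasiSplit (↥(maximalRealSubfield L)) L (IsCMField.complexConj L) 2).Adelic) K'))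
    (hHK' : ∀ (g k : (quasiSplit (↥(maximalRealSubfield L)) L (IsCMField.complexConj L) 2).Adelic), k ∈ K' → borelHeight (g * k) = borelHeight g)
    (W : Finset (quasiSplit (↥(maximalRealSubfield L)) L (IsCMField.complexConj L) 2).Adelic) (hW : ∀ g, ∃ β ∈ borelAdelic (↥(maximalRealSubfield L)) L (IsCMField.complexConj L) 2, ∃ w ∈ W, ∃ k ∈ K', g = β * w * k)
    (ω : ↥K' →* ℂ) (hω1 : ∀ k : ↥K', ‖ω k‖ = 1)
    (Wc : ClosedSubrep ((quasiSplit (↥(maximalRealSubfield L)) L (IsCMField.complexConj L) 2).rightRegular μ))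
    (hP1τ : (Wc.toSubmodule)ᗮ ⊓ (⨅ k : ↥K', Module.End.eigenspace ((((quasiSplit (↥(maximalRealSubfield L)) L (IsCMField.complexConj L) 2).rightRegular μ) (K'.subtype k) : (quasiSplit (↥(maximalRealSubfield L)) L (IsCMField.complexConj L) 2).L2 μ →L[ℂ] (quasiSplit (↥(maximalRealSubfield L)) L (IsCMField.complexConj L) 2).L2 μ) :
        (quasiSplit (↥(maximalRealSubfield L)) L (IsCMField.complexConj L) 2).L2 μ →ₗ[ℂ] (quasiSplit (↥(maximalRealSubfield L)) L (IsCMField.complexConj L) 2).L2 μ) (ω k)) =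
      (Submodule.span ℂ {f : (quasiSplit (↥(maximalRealSubfield L)) L (IsCMField.complexConj L) 2).L2 μ | ∃ (i : 𝔓.ι) (Φ : (quasiSplit (↥(maximalRealSubfield L)) L (IsCMField.complexConj L) 2).Adelic → ℂ) (_ : Measurable Φ)
        (_ : ∀ (g : (quasiSplit (↥(maximalRealSubfield L)) L (IsCMField.complexConj L) 2).Adelic) (n : 𝔓.radical i), Φ (g * n) = Φ g)
        (_ : ∫⁻ x, (∑' q : (quasiSplit (↥(maximalRealSubfield L)) L (IsCMField.complexConj L) 2).quotientSubgroup ⧸ (𝔓.radical i).subgroupOf (quasiSplit (↥(maximalRealSubfield L)) L (IsCMField.complexConj L) 2).quotientSubgroup,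
          ‖Φ ((Quotient.out x : (quasiSplit (↥(maximalRealSubfield L)) L (IsCMField.complexConj L) 2).Adelic) * ((q.out : (quasiSplit (↥(maximalRealSubfield L)) L (IsCMField.complexConj L) 2).quotientSubgroup) : (quasiSplit (↥(maximalRealSubfield L)) L (IsCMField.complexConj L) 2).Adelic))‖ₑ) ^ 2 ∂μ < ∞)
        (_ : Continuous Φ) (_ : ∃ M : ℝ, ∀ g, ‖Φ g‖ ≤ M) (_ : ∃ C : Set (quasiSplit (↥(maximalRealSubfield L)) L (IsCMField.complexConj L) 2).Adelic, IsCompact C ∧ ∀ g, g ∉ C * ((𝔓.radical i : Subgroup (quasiSplit (↥(maximalRealSubfield L)) L (IsCMField.complexConj L) 2).Adelic) : Set (quasiSplit (↥(maximalRealSubfield L)) L (IsCMField.complexConj L) 2).Adelic) → Φ g = 0)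
        (_ : ∀ (k : ↥K') (h : (quasiSplit (↥(maximalRealSubfield L)) L (IsCMField.complexConj L) 2).Adelic), Φ (K'.subtype k * h) = (ω k)⁻¹ * Φ h)
        (hθ : MemLp (fun x : (quasiSplit (↥(maximalRealSubfield L)) L (IsCMField.complexConj L) 2).automorphicQuotient => ∑' q : (quasiSplit (↥(maximalRealSubfield L)) L (IsCMField.complexConj L) 2).quotientSubgroup ⧸ (𝔓.radical i).subgroupOf (quasiSplit (↥(maximalRealSubfield L)) L (IsCMField.complexConj L) 2).quotientSubgroup,
          Φ ((Quotient.out x : (quasiSplit (↥(maximalRealSubfield L)) L (IsCMField.complexConj L) 2).Adelic) * ((q.out : (quasiSplit (↥(maximalRealSubfield L)) L (IsCMField.complexConj L) 2).quotientSubgroup) : (quasiSplit (↥(maximalRealSubfield L)) L (IsCMField.complexConj L) 2).Adelic))) 2 μ), f = hθ.toLp _}).topologicalClosure) :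
    (Wc.toSubmodule)ᗮ ⊓ (⨅ k : ↥K', Module.End.eigenspace ((((quasiSplit (↥(maximalRealSubfield L)) L (IsCMField.complexConj L) 2).rightRegular μ) (K'.subtype k) : (quasiSplit (↥(maximalRealSubfield L)) L (IsCMField.complexConj L) 2).L2 μ →L[ℂ] (quasiSplit (↥(maximalRealSubfield L)) L (IsCMField.complexConj L) 2).L2 μ) :
        (quasiSplit (↥(maximalRealSubfield L)) L (IsCMField.complexConj L) 2).L2 μ →ₗ[ℂ] (quasiSplit (↥(maximalRealSubfield L)) L (IsCMField.complexConj L) 2).L2 μ) (ω k)) ≤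
      (⨆ χ ∈ {χ : HeckeCharacter L | (∀ r : ℝ≥0ˣ, χ (posRealIdele L r) = 1) ∧ chiSectionSpace χ K' (ω : ↥K' → ℂ) ≠ ⊥},
        Submodule.span ℂ {v : (quasiSplit (↥(maximalRealSubfield L)) L (IsCMField.complexConj L) 2).L2 μ |
          ∃ (f : ℝ → ℂ) (_ : Continuous f) (_ : HasCompactSupport f) (_ : tsupport f ⊆ Ioi 0)
            (φ : (quasiSplit (↥(maximalRealSubfield L)) L (IsCMField.complexConj L) 2).Adelic → ℂ) (_ : φ ∈ chiSectionSpace χ K' (ω : ↥K' → ℂ)) (_ : Continuous φ)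
            (hv : MemLp ((quasiSplit (↥(maximalRealSubfield L)) L (IsCMField.complexConj L) 2).quotFun (eisensteinSeriesU (fun g => f (borelHeight g) * φ g))) 2 μ), v = hv.toLp _}).topologicalClosure := by
  rw [hP1τ]
  refine Submodule.topologicalClosure_minimal _ (Submodule.span_le.2 ?_) (Submodule.isClosed_topologicalClosure _)
  rintro v ⟨i, Φ, hΦm, hΦ, h2, hΦc, hM, hC, hK, hθ, rfl⟩
  exact toLp_pseudoEisenstein_mem_closure_biSup_family_open L μ hc 𝔓 h𝔓 K' hdo hHK' W hW ω hω1 i hΦm hΦ h2 hΦc hM hC hK hθ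

/-- **THE C7 HEAD″ IN BLOCK CURRENCY (hypothesis-first on the P1b_τ head `hP1τ`; NO finiteness conjunct)**: the blocks `Blk_ω b = closure span(ω-family b)`, `b` ranging over ALL
`χ` with `V(χ,K′,ω) ≠ ⊥` (an INFINITE set at `Kad` when `[L⁺:ℚ] ≥ 2`), are complete, and `Wᗮ ∩ L²(X)^{(K′,ω)} ≤ closure ⨆_b Blk_ω b` (§3 + monotonicity) — the input of an infinite-block
`hEXH`; the cut to the finitely many pole-carrying blocks is the spectral step of the `hatoms` assembly. [cite: MoeglinWaldspurger1995, II.2.4] [cite: ReedSimonI1980, Thm. II.3] -/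
theorem blocks_open (hc : IsCMField.complexConj L * IsCMField.complexConj L = 1)
    [MeasurableSpace (quasiSplit (↥(maximalRealSubfield L)) L (IsCMField.complexConj L) 2).Adelic] [BorelSpace (quasiSplit (↥(maximalRealSubfield L)) L (IsCMField.complexConj L) 2).Adelic] [(quasiSplit (↥(maximalRealSubfield L)) L (IsCMField.complexConj L) 2).IsAutomorphicMeasure μ]
    (𝔓 : (quasiSplit (↥(maximalRealSubfield L)) L (IsCMField.complexConj L) 2).ParabolicUnipotentData) (h𝔓 : ∀ i : 𝔓.ι, 𝔓.radical i = adelicUnipotent (↥(maximalRealSubfield L)) L (IsCMField.complexConj L) 2)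
    (K' : Subgroup (quasiSplit (↥(maximalRealSubfield L)) L (IsCMField.complexConj L) 2).Adelic) (hdo : ∀ w' : (quasiSplit (↥(maximalRealSubfield L)) L (IsCMField.complexConj L) 2).Adelic, IsOpen (DoubleCoset.doubleCoset w' (borelAdelic (↥(maximalRealSubfield L)) L (IsCMField.complexConj L) 2 : Set (quasiSplit (↥(maximalRealSubfield L)) L (IsCMField.complexConj L) 2).Adelic) K'))
    (hHK' : ∀ (g k : (quasiSplit (↥(maximalRealSubfield L)) L (IsCMField.complexConj L) 2).Adelic), k ∈ K' → borelHeight (g * k) = borelHeight g)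
    (W : Finset (quasiSplit (↥(maximalRealSubfield L)) L (IsCMField.complexConj L) 2).Adelic) (hW : ∀ g, ∃ β ∈ borelAdelic (↥(maximalRealSubfield L)) L (IsCMField.complexConj L) 2, ∃ w ∈ W, ∃ k ∈ K', g = β * w * k)
    (ω : ↥K' →* ℂ) (hω1 : ∀ k : ↥K', ‖ω k‖ = 1)
    (Wc : ClosedSubrep ((quasiSplit (↥(maximalRealSubfield L)) L (IsCMField.complexConj L) 2).rightRegular μ))
    (hP1τ : (Wc.toSubmodule)ᗮ ⊓ (⨅ k : ↥K', Module.End.eigenspace ((((quasiSplit (↥(maximalRealSubfield L)) L (IsCMField.complexConj L) 2).rightRegular μ) (K'.subtype k) : (quasiSplit (↥(maximalRealSubfield L)) L (IsCMField.complexConj L) 2).L2 μ →L[ℂ] (quasiSplit (↥(maximalRealSubfield L)) L (IsCMField.complexConj L) 2).L2 μ) :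
        (quasiSplit (↥(maximalRealSubfield L)) L (IsCMField.complexConj L) 2).L2 μ →ₗ[ℂ] (quasiSplit (↥(maximalRealSubfield L)) L (IsCMField.complexConj L) 2).L2 μ) (ω k)) =
      (Submodule.span ℂ {f : (quasiSplit (↥(maximalRealSubfield L)) L (IsCMField.complexConj L) 2).L2 μ | ∃ (i : 𝔓.ι) (Φ : (quasiSplit (↥(maximalRealSubfield L)) L (IsCMField.complexConj L) 2).Adelic → ℂ) (_ : Measurable Φ)
        (_ : ∀ (g : (quasiSplit (↥(maximalRealSubfield L)) L (IsCMField.complexConj L) 2).Adelic) (n : 𝔓.radical i), Φ (g * n) = Φ g)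
        (_ : ∫⁻ x, (∑' q : (quasiSplit (↥(maximalRealSubfield L)) L (IsCMField.complexConj L) 2).quotientSubgroup ⧸ (𝔓.radical i).subgroupOf (quasiSplit (↥(maximalRealSubfield L)) L (IsCMField.complexConj L) 2).quotientSubgroup,
          ‖Φ ((Quotient.out x : (quasiSplit (↥(maximalRealSubfield L)) L (IsCMField.complexConj L) 2).Adelic) * ((q.out : (quasiSplit (↥(maximalRealSubfield L)) L (IsCMField.complexConj L) 2).quotientSubgroup) : (quasiSplit (↥(maximalRealSubfield L)) L (IsCMField.complexConj L) 2).Adelic))‖ₑ) ^ 2 ∂μ < ∞)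
        (_ : Continuous Φ) (_ : ∃ M : ℝ, ∀ g, ‖Φ g‖ ≤ M) (_ : ∃ C : Set (quasiSplit (↥(maximalRealSubfield L)) L (IsCMField.complexConj L) 2).Adelic, IsCompact C ∧ ∀ g, g ∉ C * ((𝔓.radical i : Subgroup (quasiSplit (↥(maximalRealSubfield L)) L (IsCMField.complexConj L) 2).Adelic) : Set (quasiSplit (↥(maximalRealSubfield L)) L (IsCMField.complexConj L) 2).Adelic) → Φ g = 0)
        (_ : ∀ (k : ↥K') (h : (quasiSplit (↥(maximalRealSubfield L)) L (IsCMField.complexConj L) 2).Adelic), Φ (K'.subtype k * h) = (ω k)⁻¹ * Φ h)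
        (hθ : MemLp (fun x : (quasiSplit (↥(maximalRealSubfield L)) L (IsCMField.complexConj L) 2).automorphicQuotient => ∑' q : (quasiSplit (↥(maximalRealSubfield L)) L (IsCMField.complexConj L) 2).quotientSubgroup ⧸ (𝔓.radical i).subgroupOf (quasiSplit (↥(maximalRealSubfield L)) L (IsCMField.complexConj L) 2).quotientSubgroup,
          Φ ((Quotient.out x : (quasiSplit (↥(maximalRealSubfield L)) L (IsCMField.complexConj L) 2).Adelic) * ((q.out : (quasiSplit (↥(maximalRealSubfield L)) L (IsCMField.complexConj L) 2).quotientSubgroup) : (quasiSplit (↥(maximalRealSubfield L)) L (IsCMField.complexConj L) 2).Adelic))) 2 μ), f = hθ.toLp _}).topologicalClosure) :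
    (∀ b : ↥{χ : HeckeCharacter L | (∀ r : ℝ≥0ˣ, χ (posRealIdele L r) = 1) ∧ chiSectionSpace χ K' (ω : ↥K' → ℂ) ≠ ⊥},
        CompleteSpace ↥(Submodule.span ℂ {v : (quasiSplit (↥(maximalRealSubfield L)) L (IsCMField.complexConj L) 2).L2 μ |
          ∃ (f : ℝ → ℂ) (_ : Continuous f) (_ : HasCompactSupport f) (_ : tsupport f ⊆ Ioi 0)
            (φ : (quasiSplit (↥(maximalRealSubfield L)) L (IsCMField.complexConj L) 2).Adelic → ℂ) (_ : φ ∈ chiSectionSpace (b : HeckeCharacter L) K' (ω : ↥K' → ℂ)) (_ : Continuous φ)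
            (hv : MemLp ((quasiSplit (↥(maximalRealSubfield L)) L (IsCMField.complexConj L) 2).quotFun (eisensteinSeriesU (fun g => f (borelHeight g) * φ g))) 2 μ), v = hv.toLp _}).topologicalClosure) ∧
      (Wc.toSubmodule)ᗮ ⊓ (⨅ k : ↥K', Module.End.eigenspace ((((quasiSplit (↥(maximalRealSubfield L)) L (IsCMField.complexConj L) 2).rightRegular μ) (K'.subtype k) : (quasiSplit (↥(maximalRealSubfield L)) L (IsCMField.complexConj L) 2).L2 μ →L[ℂ] (quasiSplit (↥(maximalRealSubfield L)) L (IsCMField.complexConj L) 2).L2 μ) :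
          (quasiSplit (↥(maximalRealSubfield L)) L (IsCMField.complexConj L) 2).L2 μ →ₗ[ℂ] (quasiSplit (↥(maximalRealSubfield L)) L (IsCMField.complexConj L) 2).L2 μ) (ω k)) ≤
        (⨆ b : ↥{χ : HeckeCharacter L | (∀ r : ℝ≥0ˣ, χ (posRealIdele L r) = 1) ∧ chiSectionSpace χ K' (ω : ↥K' → ℂ) ≠ ⊥},
          (Submodule.span ℂ {v : (quasiSplit (↥(maximalRealSubfield L)) L (IsCMField.complexConj L) 2).L2 μ |
            ∃ (f : ℝ → ℂ) (_ : Continuous f) (_ : HasCompactSupport f) (_ : tsupport f ⊆ Ioi 0)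
              (φ : (quasiSplit (↥(maximalRealSubfield L)) L (IsCMField.complexConj L) 2).Adelic → ℂ) (_ : φ ∈ chiSectionSpace (b : HeckeCharacter L) K' (ω : ↥K' → ℂ)) (_ : Continuous φ)
              (hv : MemLp ((quasiSplit (↥(maximalRealSubfield L)) L (IsCMField.complexConj L) 2).quotFun (eisensteinSeriesU (fun g => f (borelHeight g) * φ g))) 2 μ), v = hv.toLp _}).topologicalClosure).topologicalClosure := by
  refine ⟨fun b => (Submodule.isClosed_topologicalClosure _).completeSpace_coe,
    (orthogonal_inf_isotypic_le_topologicalClosure_biSup_family_open L μ hc 𝔓 h𝔓 K' hdo hHK' W hW ω hω1 Wc hP1τ).trans ?_⟩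
  refine Submodule.topologicalClosure_mono ?_
  refine iSup₂_le fun χ hχ => ?_
  exact (Submodule.le_topologicalClosure _).trans (le_iSup (fun b : ↥{χ : HeckeCharacter L | (∀ r : ℝ≥0ˣ, χ (posRealIdele L r) = 1) ∧ chiSectionSpace χ K' (ω : ↥K' → ℂ) ≠ ⊥} =>
    (Submodule.span ℂ {v : (quasiSplit (↥(maximalRealSubfield L)) L (IsCMField.complexConj L) 2).L2 μ |
        ∃ (f : ℝ → ℂ) (_ : Continuous f) (_ : HasCompactSupport f) (_ : tsupport f ⊆ Ioi 0)
          (φ : (quasiSplit (↥(maximalRealSubfield L)) L (IsCMField.complexConj L) 2).Adelic → ℂ) (_ : φ ∈ chiSectionSpace (b : HeckeCharacter L) K' (ω : ↥K' → ℂ)) (_ : Continuous φ)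
          (hv : MemLp ((quasiSplit (↥(maximalRealSubfield L)) L (IsCMField.complexConj L) 2).quotFun (eisensteinSeriesU (fun g => f (borelHeight g) * φ g))) 2 μ), v = hv.toLp _}).topologicalClosure) ⟨χ, hχ⟩)

end Summit.HodgeConjecture.HodgeConjecture.Cruxes.H413.K2E1PseudoEisensteinFamilyDecompositionOpenCosetsU2

end
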